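import Literature.MathematicalPhysics.QuantumFieldTheory.Balaban1983to89.B8Prop5KLevelLetters
import Literature.MathematicalPhysics.QuantumFieldTheory.Balaban1983to89.B8Lemma1NonAbelian
import Literature.MathematicalPhysics.QuantumFieldTheory.Balaban1983to89.B8Eq119TwistedAxial

/-!
# `Balaban1983to89.B8Prop5SocketsOfHFP` — [Balaban1985RegularSpaces] PROPOSITION 5 (pp. 93–94) AS THE GUARDED SOCKETS `SP5base` / `SP5`
# OF THE LEAF-SHAPE THEOREM 4 (`B8Thm4Concrete.thm4Body_concrete_guarded`), SERVED FROM THE GUARDED PLAIN-CURRENCY FIXED POINT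

statement-level skeleton of published theorems with citation tags; proofs where landed; nothing here is a claim about the
Yang–Mills mass gap

T. Bałaban, *Spaces of regular gauge field configurations on a lattice and gauge fixing conditions*, Commun. Math. Phys. **99**
(1985) 75–102 `[Balaban1985RegularSpaces]` ("B8"), Proposition 5 pp. 93–94, (1.106)–(1.110) p. 94, Theorem 4 p. 88.
STATUS: published, refereed.

CITATION HEADER (lean-in-tree rule).  Cell `pub-ymgap` (YM Track A, DAG node N05 = [B8], HUMAN RULING D-0062), seat `pub-ymgap-dag-n04-b`
gen 2, REBALANCE №41-a.  WHAT IS REPRODUCED: the owner's guarded Proposition-5 sockets of `B8Thm4Concrete.thm4Body_concrete_guarded`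
(n05-a, p422643) — `SP5base` / `SP5`, each quantified over `α₀, α₁ > 0` with `α₀ + α₁ ≤ cP`, the unitary data `U₀, U′` and the datum's
(1.33)/(1.34)/(1.34)-axial/(1.35)/(1.66)₀ hypotheses, at the explicit constants `c⋆ = 5dLB₀(α₀ + α₁)`, `α₄ = 8B₀′c⋆`, `a = α₁` — are
DELIVERED, letter for letter, from the same-shaped guarded hypotheses `SHFP₀` / `SHFP` carrying the Prop.-5 fixed point in PLAIN currency
(`B8Prop5KLevelLetters.hP5_step_of_HFP`: `λ` Hermitian, `= 0` off `Ω₀`, (1.108), the multiplier form of the Landau equation for the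
D*-identity's right-hand side, (1.29) for `u₁·e^{iλ}`), provided the guard threshold `cP` is below the three explicit windows
`84·α₄ ≤ 1`, `12·c⋆ ≤ 1`, `4·α₁ ≤ 1` at `α₀ + α₁ = cP` (and `2 ≤ 5dLB₀` for `2a ≤ c⋆`).  Kind «kernel-checked proof», no `def`,
no `… : Prop` fact.

## WHAT IS CERTIFIED HERE (kernel; axioms `propext` / `Classical.choice` / `Quot.sound`)

* `SP5_of_SHFP` — the guarded socket `SP5` (levels `1 ≤ m < k`) from the guarded `SHFP`;
* `SP5base_of_SHFP` — the guarded socket `SP5base` (the first step) from the guarded `SHFP₀` (base datum `A₀ = (iη)⁻¹ log U′` via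
  `B8Thm4TruncationLocal.base_datum`, `|U′ − 1| ≤ α₁` on the sides of the plaquettes touching `Ω₀`).
With these, `thm4Body_concrete_guarded … (SP5base_of_SHFP …) (SP5_of_SHFP …) SH59 SP5u` is Theorem 4 in the leaf's quantifier shape
modulo the plain-currency fixed point, the in-edge b9 and the uniqueness socket.

HONEST SCOPE.  Socket plumbing only; the fixed point (`SHFP₀`, `SHFP` — №41-b, `B8Prop5ContractionKLevel` + letters of [4]) remains a
hypothesis; count-neutral; N05 NOT discharged; `T_η ↦ ℤᵈ`; nothing continuum / mass-gap / Clay.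
-/

noncomputable section

open NormedSpace

namespace Literature.MathematicalPhysics.QuantumFieldTheory.Balaban1983to89.B8Prop5SocketsOfHFP

open MatrixLog B7Prop1Explicit B7Prop2Explicit B7Prop1Local B7Eq92Concrete
open B7Eq78Linearization (conjR)
open B8Ineq132 (covDerivFwd InAk)
open B8Eq119TwistedAxial (Restr129 InAx)
open B8Eq182Proof (gAd)
open B8Eq184Proof (gaugeExp cfgExp)
open B8Eq188Proof (frakF3)
open B8Lemma1NonAbelian (mulCfg)
open B8Eq140Level (SideTouches)
open B8Eq138LandauZd (covDivB covLap QT IsLandau138W)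
open B8Prop5KLevelLetters (hP5base_of_HFP hP5_of_HFP)

-- `Site` alone could resolve to the torus sites of `Setup.lean`; re-export the `ℤ^d` sites of `B7Prop1Explicit`.
export B7Prop1Explicit (Site)

variable {d : ℕ} {𝔸 : Type*} [CStarAlgebra 𝔸] [Nontrivial 𝔸]

/-- The three windows from the guard: `α₀ + α₁ ≤ cP` with `84·(8B₀′·5dLB₀·cP) ≤ 1`, `12·(5dLB₀·cP) ≤ 1`, `4·cP ≤ 1` give
`α₄ ≤ 1/84`, `c⋆ ≤ 1/12`, `α₁ ≤ 1/4` (monotonicity in `α₀ + α₁`). [cite: Balaban1985RegularSpaces, Prop. 5 p.94 («α₄ sufficiently small»)] -/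
private theorem windows_of_guard {L : ℕ} {B₀ B₀' cP α₀ α₁ : ℝ} (hB₀ : 0 ≤ B₀) (hB₀' : 0 ≤ B₀') (hα₀ : 0 < α₀)
    (hS : α₀ + α₁ ≤ cP) (h84 : 84 * (8 * B₀' * (5 * (d : ℝ) * L * B₀) * cP) ≤ 1) (h12 : 12 * (5 * (d : ℝ) * L * B₀ * cP) ≤ 1)
    (h4 : 4 * cP ≤ 1) :
    8 * B₀' * (5 * (d : ℝ) * L * B₀) * (α₀ + α₁) ≤ 1 / 84 ∧ 5 * (d : ℝ) * L * B₀ * (α₀ + α₁) ≤ 1 / 12 ∧ α₁ ≤ 1 / 4 := by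
  have hK : 0 ≤ 5 * (d : ℝ) * L * B₀ := by positivity
  have hK' : 0 ≤ 8 * B₀' * (5 * (d : ℝ) * L * B₀) := by positivity
  refine ⟨?_, ?_, ?_⟩
  · have := mul_le_mul_of_nonneg_left hS hK'
    linarith
  · have := mul_le_mul_of_nonneg_left hS hK
    linarith
  · linarith

/-- **The guarded socket `SP5` of `B8Thm4Concrete.thm4Body_concrete_guarded` from the guarded plain-currency fixed point `SHFP`**
(levels `1 ≤ m < k`; `c⋆ = 5dLB₀(α₀ + α₁)`, `α₄ = 8B₀′c⋆`): `B8Prop5KLevelLetters.hP5_of_HFP` under the guard, the windows `α₄ ≤ 1/84`,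
`c⋆ ≤ 1/12` read off the threshold `cP`. [cite: Balaban1985RegularSpaces, Prop. 5 pp.93–94, (1.106)–(1.110) p.94] -/
theorem SP5_of_SHFP (hd2 : 2 ≤ d) {η : ℝ} (hη : 0 < η) (L k : ℕ) {B₀ B₀' cP : ℝ} (hB₀ : 0 ≤ B₀) (hB₀' : 0 ≤ B₀')
    (h84 : 84 * (8 * B₀' * (5 * (d : ℝ) * L * B₀) * cP) ≤ 1) (h12 : 12 * (5 * (d : ℝ) * L * B₀ * cP) ≤ 1) (h4 : 4 * cP ≤ 1)
    (Ω : ℕ → Set (Site d)) (Λs : ℕ → ℕ → Set (Site d))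
    (SHFP : ∀ α₀ α₁ : ℝ, 0 < α₀ → 0 < α₁ → α₀ + α₁ ≤ cP →
      ∀ U₀ U' : Site d → Fin d → 𝔸ˣ, (∀ x κ, U₀ x κ ∈ unitaryUnits 𝔸) → (∀ x κ, U' x κ ∈ unitaryUnits 𝔸) →
      InAk L k η α₀ Ω U₀ → InAk L k η α₀ Ω (mulCfg U' U₀) → (∀ m, m ≤ k → InAx L m (Λs m) U₀ (mulCfg U' U₀)) →
      (∀ j, j ≤ k → ∀ (z : Site d) (μ : Fin d), (∀ x, InBox (loK L j z) (bondHiK L j z μ) x → x ∈ Ω j) →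
        ‖(avgIter L (mulCfg U' U₀) j z μ : 𝔸) - (avgIter L U₀ j z μ : 𝔸)‖ ≤ α₁) →
      (∀ b ∈ {b : Site d × Fin d | SideTouches (Ω 0) b.1 b.2}, ‖((U' b.1 b.2 : 𝔸ˣ) : 𝔸) - 1‖ ≤ α₁) →
      ∀ m, 1 ≤ m → m < k → ∀ (u₁ : Site d → 𝔸ˣ) (U₁ : Site d → Fin d → 𝔸ˣ) (A : Site d → Fin d → 𝔸),
        (∀ x, u₁ x ∈ unitaryUnits 𝔸) → (∀ x, x ∉ Ω 0 → u₁ x = 1) → mgauge U₀ u₁ U₁ = U' → Restr129 L m (Λs m) U₀ u₁ →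
        IsLandau138W L m η (Ω 0) (Λs m) U₀ U₁ →
        (∀ j, j ≤ m → ∀ b ∈ {b : Site d × Fin d | SideTouches (Ω j) b.1 b.2},
          U₁ b.1 b.2 = cfgExp η A b.1 b.2 ∧ IsSelfAdjoint (A b.1 b.2) ∧
            ‖A b.1 b.2‖ ≤ (5 * (d : ℝ) * L * B₀ * (α₀ + α₁)) * ((L : ℝ) ^ j * η)⁻¹) →
        ∃ lam : Site d → 𝔸, (∀ x, IsSelfAdjoint (lam x)) ∧ (∀ x, x ∉ Ω 0 → lam x = 0) ∧
          (∀ j, j ≤ m + 1 → ∀ b ∈ {b : Site d × Fin d | SideTouches (Ω j) b.1 b.2},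
            ‖lam b.1‖ ≤ (8 * B₀' * (5 * (d : ℝ) * L * B₀) * (α₀ + α₁)) ∧
              ((L : ℝ) ^ j * η) * ‖covDerivFwd η U₀ b.2 lam b.1‖ ≤ (8 * B₀' * (5 * (d : ℝ) * L * B₀) * (α₀ + α₁))) ∧
          (∃ μ : ℕ → Site d → 𝔸, ∀ x ∈ Ω 0,
            covLap η U₀ ((Ω 0).indicator fun y => covDivB η U₀ A y + covLap η U₀ lam y +
              ((conjR (gaugeExp lam y)⁻¹ (covDivB η U₀ A y) - covDivB η U₀ A y) +
                (gAd (covLap η U₀ lam y) (lam y) - covLap η U₀ lam y) + ∑ μ, frakF3 η U₀ lam A y μ)) x =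
              QT L (m + 1) (Λs (m + 1)) U₀ μ x) ∧
          Restr129 L (m + 1) (Λs (m + 1)) U₀ (u₁ * gaugeExp lam)) :
    ∀ α₀ α₁ : ℝ, 0 < α₀ → 0 < α₁ → α₀ + α₁ ≤ cP →
      ∀ U₀ U' : Site d → Fin d → 𝔸ˣ, (∀ x κ, U₀ x κ ∈ unitaryUnits 𝔸) → (∀ x κ, U' x κ ∈ unitaryUnits 𝔸) →
      InAk L k η α₀ Ω U₀ → InAk L k η α₀ Ω (mulCfg U' U₀) → (∀ m, m ≤ k → InAx L m (Λs m) U₀ (mulCfg U' U₀)) →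
      (∀ j, j ≤ k → ∀ (z : Site d) (μ : Fin d), (∀ x, InBox (loK L j z) (bondHiK L j z μ) x → x ∈ Ω j) →
        ‖(avgIter L (mulCfg U' U₀) j z μ : 𝔸) - (avgIter L U₀ j z μ : 𝔸)‖ ≤ α₁) →
      (∀ b ∈ {b : Site d × Fin d | SideTouches (Ω 0) b.1 b.2}, ‖((U' b.1 b.2 : 𝔸ˣ) : 𝔸) - 1‖ ≤ α₁) →
      (∀ m, 1 ≤ m → m < k → ∀ (u₁ : Site d → 𝔸ˣ) (U₁ : Site d → Fin d → 𝔸ˣ) (A : Site d → Fin d → 𝔸),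
        (∀ x, u₁ x ∈ unitaryUnits 𝔸) → (∀ x, x ∉ Ω 0 → u₁ x = 1) → mgauge U₀ u₁ U₁ = U' → Restr129 L m (Λs m) U₀ u₁ →
        IsLandau138W L m η (Ω 0) (Λs m) U₀ U₁ →
        (∀ j, j ≤ m → ∀ b ∈ {b : Site d × Fin d | SideTouches (Ω j) b.1 b.2},
        U₁ b.1 b.2 = cfgExp η A b.1 b.2 ∧ IsSelfAdjoint (A b.1 b.2) ∧ ‖A b.1 b.2‖ ≤ (5 * (d : ℝ) * L * B₀ * (α₀ + α₁)) * ((L : ℝ) ^ j * η)⁻¹) →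
        ∃ (v : Site d → 𝔸ˣ) (lam : Site d → 𝔸), (∀ x, v x ∈ unitaryUnits 𝔸) ∧ (∀ x, x ∉ Ω 0 → v x = 1) ∧
        (∀ j, j ≤ m + 1 → ∀ b ∈ {b : Site d × Fin d | SideTouches (Ω j) b.1 b.2}, (v b.1 : 𝔸) = ((gaugeExp lam b.1 : 𝔸ˣ) : 𝔸) ∧
        (v (b.1 + e b.2) : 𝔸) = ((gaugeExp lam (b.1 + e b.2) : 𝔸ˣ) : 𝔸)) ∧
        (∀ j, j ≤ m + 1 → ∀ b ∈ {b : Site d × Fin d | SideTouches (Ω j) b.1 b.2},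
        ‖lam b.1‖ ≤ (8 * B₀' * (5 * (d : ℝ) * L * B₀) * (α₀ + α₁)) ∧ ((L : ℝ) ^ j * η) * ‖covDerivFwd η U₀ b.2 lam b.1‖ ≤ (8 * B₀' * (5 * (d : ℝ) * L * B₀) * (α₀ + α₁))) ∧
        IsLandau138W L (m + 1) η (Ω 0) (Λs (m + 1)) U₀ (mgauge U₀ v⁻¹ U₁) ∧ Restr129 L (m + 1) (Λs (m + 1)) U₀ (u₁ * v)) := by
  intro α₀ α₁ hα₀ hα₁ hS U₀ U' hU₀ hU' h33 h34 hAx h135 h66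
  obtain ⟨hs₁, hcs, -⟩ := windows_of_guard (L := L) hB₀ hB₀' hα₀ hS h84 h12 h4
  exact hP5_of_HFP hd2 hη L k hU₀ hs₁ hcs Ω Λs (SHFP α₀ α₁ hα₀ hα₁ hS U₀ U' hU₀ hU' h33 h34 hAx h135 h66)

/-- **The guarded socket `SP5base` of `B8Thm4Concrete.thm4Body_concrete_guarded` from the guarded plain-currency fixed point `SHFP₀`** (the
first step, `u₁ = 1`, `U₁ = U′`, base datum `A₀ = (iη)⁻¹ log U′` with `|U′ − 1| ≤ α₁ ≤ 1/4` on the sides of the plaquettes touching `Ω₀`,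
`2α₁ ≤ c⋆` from `2 ≤ 5dLB₀`): `B8Prop5KLevelLetters.hP5base_of_HFP` under the guard.
[cite: Balaban1985RegularSpaces, Prop. 5 pp.93–94, (1.66) p.88, (1.106)–(1.110) p.94] -/
theorem SP5base_of_SHFP (hd2 : 2 ≤ d) {η : ℝ} (hη : 0 < η) (L k : ℕ) {B₀ B₀' cP : ℝ} (hB₀ : 0 ≤ B₀) (hB₀' : 0 ≤ B₀')
    (hB : 2 ≤ 5 * (d : ℝ) * L * B₀)
    (h84 : 84 * (8 * B₀' * (5 * (d : ℝ) * L * B₀) * cP) ≤ 1) (h12 : 12 * (5 * (d : ℝ) * L * B₀ * cP) ≤ 1) (h4 : 4 * cP ≤ 1)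
    (Ω : ℕ → Set (Site d)) (Λs : ℕ → ℕ → Set (Site d))
    (SHFP₀ : ∀ α₀ α₁ : ℝ, 0 < α₀ → 0 < α₁ → α₀ + α₁ ≤ cP →
      ∀ U₀ U' : Site d → Fin d → 𝔸ˣ, (∀ x κ, U₀ x κ ∈ unitaryUnits 𝔸) → (∀ x κ, U' x κ ∈ unitaryUnits 𝔸) →
      InAk L k η α₀ Ω U₀ → InAk L k η α₀ Ω (mulCfg U' U₀) → (∀ m, m ≤ k → InAx L m (Λs m) U₀ (mulCfg U' U₀)) →
      (∀ j, j ≤ k → ∀ (z : Site d) (μ : Fin d), (∀ x, InBox (loK L j z) (bondHiK L j z μ) x → x ∈ Ω j) →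
        ‖(avgIter L (mulCfg U' U₀) j z μ : 𝔸) - (avgIter L U₀ j z μ : 𝔸)‖ ≤ α₁) →
      (∀ b ∈ {b : Site d × Fin d | SideTouches (Ω 0) b.1 b.2}, ‖((U' b.1 b.2 : 𝔸ˣ) : 𝔸) - 1‖ ≤ α₁) →
      ∀ A : Site d → Fin d → 𝔸,
        (∀ j, j ≤ 0 → ∀ b ∈ {b : Site d × Fin d | SideTouches (Ω j) b.1 b.2},
          U' b.1 b.2 = cfgExp η A b.1 b.2 ∧ IsSelfAdjoint (A b.1 b.2) ∧
            ‖A b.1 b.2‖ ≤ (5 * (d : ℝ) * L * B₀ * (α₀ + α₁)) * ((L : ℝ) ^ j * η)⁻¹) →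
        ∃ lam : Site d → 𝔸, (∀ x, IsSelfAdjoint (lam x)) ∧ (∀ x, x ∉ Ω 0 → lam x = 0) ∧
          (∀ j, j ≤ 1 → ∀ b ∈ {b : Site d × Fin d | SideTouches (Ω j) b.1 b.2},
            ‖lam b.1‖ ≤ (8 * B₀' * (5 * (d : ℝ) * L * B₀) * (α₀ + α₁)) ∧
              ((L : ℝ) ^ j * η) * ‖covDerivFwd η U₀ b.2 lam b.1‖ ≤ (8 * B₀' * (5 * (d : ℝ) * L * B₀) * (α₀ + α₁))) ∧
          (∃ μ : ℕ → Site d → 𝔸, ∀ x ∈ Ω 0,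
            covLap η U₀ ((Ω 0).indicator fun y => covDivB η U₀ A y + covLap η U₀ lam y +
              ((conjR (gaugeExp lam y)⁻¹ (covDivB η U₀ A y) - covDivB η U₀ A y) +
                (gAd (covLap η U₀ lam y) (lam y) - covLap η U₀ lam y) + ∑ μ, frakF3 η U₀ lam A y μ)) x =
              QT L 1 (Λs 1) U₀ μ x) ∧
          Restr129 L 1 (Λs 1) U₀ ((1 : Site d → 𝔸ˣ) * gaugeExp lam)) :
    ∀ α₀ α₁ : ℝ, 0 < α₀ → 0 < α₁ → α₀ + α₁ ≤ cP →
      ∀ U₀ U' : Site d → Fin d → 𝔸ˣ, (∀ x κ, U₀ x κ ∈ unitaryUnits 𝔸) → (∀ x κ, U' x κ ∈ unitaryUnits 𝔸) →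
      InAk L k η α₀ Ω U₀ → InAk L k η α₀ Ω (mulCfg U' U₀) → (∀ m, m ≤ k → InAx L m (Λs m) U₀ (mulCfg U' U₀)) →
      (∀ j, j ≤ k → ∀ (z : Site d) (μ : Fin d), (∀ x, InBox (loK L j z) (bondHiK L j z μ) x → x ∈ Ω j) →
        ‖(avgIter L (mulCfg U' U₀) j z μ : 𝔸) - (avgIter L U₀ j z μ : 𝔸)‖ ≤ α₁) →
      (∀ b ∈ {b : Site d × Fin d | SideTouches (Ω 0) b.1 b.2}, ‖((U' b.1 b.2 : 𝔸ˣ) : 𝔸) - 1‖ ≤ α₁) →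
      (∃ (v : Site d → 𝔸ˣ) (lam : Site d → 𝔸), (∀ x, v x ∈ unitaryUnits 𝔸) ∧ (∀ x, x ∉ Ω 0 → v x = 1) ∧
        (∀ j, j ≤ 1 → ∀ b ∈ {b : Site d × Fin d | SideTouches (Ω j) b.1 b.2}, (v b.1 : 𝔸) = ((gaugeExp lam b.1 : 𝔸ˣ) : 𝔸) ∧
        (v (b.1 + e b.2) : 𝔸) = ((gaugeExp lam (b.1 + e b.2) : 𝔸ˣ) : 𝔸)) ∧
        (∀ j, j ≤ 1 → ∀ b ∈ {b : Site d × Fin d | SideTouches (Ω j) b.1 b.2},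
        ‖lam b.1‖ ≤ (8 * B₀' * (5 * (d : ℝ) * L * B₀) * (α₀ + α₁)) ∧ ((L : ℝ) ^ j * η) * ‖covDerivFwd η U₀ b.2 lam b.1‖ ≤ (8 * B₀' * (5 * (d : ℝ) * L * B₀) * (α₀ + α₁))) ∧
        IsLandau138W L 1 η (Ω 0) (Λs 1) U₀ (mgauge U₀ v⁻¹ U') ∧ Restr129 L 1 (Λs 1) U₀ ((1 : Site d → 𝔸ˣ) * v)) := by
  intro α₀ α₁ hα₀ hα₁ hS U₀ U' hU₀ hU' h33 h34 hAx h135 h66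
  obtain ⟨hs₁, hcs, ha⟩ := windows_of_guard (L := L) hB₀ hB₀' hα₀ hS h84 h12 h4
  have ha2 : 2 * α₁ ≤ 5 * (d : ℝ) * L * B₀ * (α₀ + α₁) := by
    have h1 : 2 * α₁ ≤ 2 * (α₀ + α₁) := by linarith
    have h2 : 2 * (α₀ + α₁) ≤ 5 * (d : ℝ) * L * B₀ * (α₀ + α₁) := mul_le_mul_of_nonneg_right hB (by linarith)
    exact h1.trans h2
  exact hP5base_of_HFP hd2 hη L hU₀ hU' hs₁ hcs ha ha2 Ω Λs h66 (SHFP₀ α₀ α₁ hα₀ hα₁ hS U₀ U' hU₀ hU' h33 h34 hAx h135 h66)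

#print axioms SP5_of_SHFP
#print axioms SP5base_of_SHFP

end Literature.MathematicalPhysics.QuantumFieldTheory.Balaban1983to89.B8Prop5SocketsOfHFP

end
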